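import Literature.Algebra.EuclideanLattices.Problems
import HarnessLib

/-!
# Scaling an integer lattice instance: `(MB)`, its lattice, Gram–Schmidt vectors and minimum distance

Topic `Algebra/EuclideanLattices` (integer lattice instances, `IntegerBases.lean` / `Problems.lean`).
Reductions that need an integer grid finer than the geometry of their input lattice `L(B)` work with the
`M`-fold copy `L(MB) = M·L(B)` (e.g. the perturbation step of Peikert's `GapSVP → LWE` reduction,
`Literature.Computability.Cryptography.PeikertPerturbation`, whose NO-case lemma `no_case_scaled` takes
the scaled instance with the hypotheses "Gram–Schmidt norms `≥ M`" and "`λ₁ > γ·M·d`"). This file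
provides the scaled instance and PROVES how the invariants transform. Everything is PROVED, [folklore].

## Results

* `gramSchmidt_const_smul`, `norm_gramSchmidt_const_smul` — Gram–Schmidt is homogeneous:
  `GS(c·f) = c·GS(f)` (`c ≠ 0`; `starProjection_span_smul`: the projection onto `ℝ(c·v)` is that onto `ℝv`).
* `LatticeInstance.scale M I` (basis matrix `M·B`, same dimension — an `abbrev`, so that
  `(I.scale M).n` is `I.n` definitionally and vectors/coefficient vectors keep their types);
  `scale_vec` (`(MB)ᵢ = M·bᵢ`), **`mem_scale_lattice_iff`** (`L(MB) = M·L(B)`), `smul_mem_scale_lattice`,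
  **`isNonsingular_scale`** (`det(MB) = Mⁿ det B ≠ 0`), **`norm_gramSchmidt_scale`** (`‖(MB)~ᵢ‖ = M‖b̃ᵢ‖`),
  **`minNorm_scale_lattice`** (`λ₁(L(MB)) = M·λ₁(L(B))`).

## Design

* `M : ℕ` (the reductions use `M = n` or a power of `2`); `M ≠ 0` where needed.
* NOT here: successive minima beyond `λ₁`, the dual of the scaled lattice (`(ML)* = M⁻¹L*`), covolume.
-/

noncomputable section

open InnerProductSpace Finset Module
open scoped RealInnerProductSpace Pointwise

namespace Literature.Algebra.EuclideanLattices

/-! ### Gram–Schmidt commutes with scaling -/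

section GramSchmidt

variable {E : Type*} [NormedAddCommGroup E] [InnerProductSpace ℝ E]
variable {ι : Type*} [LinearOrder ι] [LocallyFiniteOrderBot ι] [WellFoundedLT ι]

/-- The orthogonal projection onto a line does not change when the spanning vector is scaled by a
nonzero real. [folklore] -/
theorem starProjection_span_smul {c : ℝ} (hc : c ≠ 0) (v w : E) :
    (ℝ ∙ (c • v)).starProjection w = (ℝ ∙ v).starProjection w := by
  rw [Submodule.starProjection_singleton, Submodule.starProjection_singleton, real_inner_smul_left,
    norm_smul, Real.norm_eq_abs, smul_smul]
  by_cases hv : v = 0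
  · simp [hv]
  · have hvn : ‖v‖ ≠ 0 := norm_ne_zero_iff.2 hv
    congr 1
    simp only [RCLike.ofReal_real_eq_id, id_eq, mul_pow, sq_abs]
    field_simp

/-- **Gram–Schmidt is homogeneous**: `GS(c·f) = c·GS(f)` for a nonzero real `c` (each Gram–Schmidt
vector is a fixed linear combination of the inputs; the projections onto the lines `ℝ b̃ᵢ` are
unchanged by scaling `b̃ᵢ`). [folklore] -/
theorem gramSchmidt_const_smul {c : ℝ} (hc : c ≠ 0) (f : ι → E) (n : ι) :
    gramSchmidt ℝ (fun i => c • f i) n = c • gramSchmidt ℝ f n := by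
  refine WellFounded.induction
    (C := fun n => gramSchmidt ℝ (fun i => c • f i) n = c • gramSchmidt ℝ f n) wellFounded_lt n
    (fun n ih => ?_)
  rw [gramSchmidt_def, gramSchmidt_def ℝ f n, smul_sub, smul_sum]
  congr 1
  refine Finset.sum_congr rfl fun i hi => ?_
  rw [ih i (Finset.mem_Iio.1 hi), starProjection_span_smul hc, map_smul]

/-- Norms of Gram–Schmidt vectors scale: `‖GS(c·f)ᵢ‖ = |c|·‖GS(f)ᵢ‖`. [folklore] -/
theorem norm_gramSchmidt_const_smul {c : ℝ} (hc : c ≠ 0) (f : ι → E) (n : ι) :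
    ‖gramSchmidt ℝ (fun i => c • f i) n‖ = |c| * ‖gramSchmidt ℝ f n‖ := by
  rw [gramSchmidt_const_smul hc, norm_smul, Real.norm_eq_abs]

end GramSchmidt

/-! ### The scaled instance -/

namespace LatticeInstance

/-- The `M`-fold scaled instance `MB` (all basis vectors multiplied by the natural number `M`): same
dimension, basis matrix `M·B`. Used to refine the integer grid of a reduction relative to the lattice
(Peikert 2009, proof of Thm. 3.1, "by using a suitable amount of precision", full version p. 7).
[cite: Peikert2009, §2 (full version p. 7)] -/
abbrev scale (M : ℕ) (I : LatticeInstance) : LatticeInstance :=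
  ⟨I.n, fun i j => (M : ℤ) * I.basis i j⟩

variable (M : ℕ) (I : LatticeInstance)

/-- Scaling keeps the dimension (definitionally). [folklore] -/
@[simp] theorem scale_n : (I.scale M).n = I.n := rfl

/-- The basis matrix of the scaled instance. [folklore] -/
@[simp] theorem scale_basis (i j : Fin I.n) : (I.scale M).basis i j = (M : ℤ) * I.basis i j := rfl

/-- The basis vectors of the scaled instance are `M·bᵢ`. [folklore] -/
theorem scale_vec (i : Fin I.n) : (I.scale M).vec i = (M : ℝ) • I.vec i := by
  ext j
  simp [vec_apply, scale]

/-- The rows of `MB` as a function: `(MB)ᵢ = M·bᵢ`. [folklore] -/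
theorem scale_vec_eq : (I.scale M).vec = fun i => (M : ℝ) • I.vec i :=
  funext (scale_vec M I)

/-- **The lattice of the scaled instance is the scaled lattice**: `x ∈ L(MB) ↔ x = M·y` for some
`y ∈ L(B)`. [folklore] -/
theorem mem_scale_lattice_iff (x : EuclideanSpace ℝ (Fin I.n)) :
    x ∈ (I.scale M).lattice ↔ ∃ y ∈ I.lattice, x = (M : ℝ) • y := by
  constructor
  · intro hx
    obtain ⟨z, rfl⟩ := ((I.scale M).mem_lattice_iff x).1 hx
    refine ⟨I.ofCoeffs z, I.ofCoeffs_mem_lattice z, ?_⟩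
    rw [ofCoeffs_eq_sum, ofCoeffs_eq_sum, smul_sum]
    refine Finset.sum_congr rfl fun i _ => ?_
    rw [scale_vec]
    exact smul_comm _ _ _
  · rintro ⟨y, hy, rfl⟩
    obtain ⟨z, rfl⟩ := (I.mem_lattice_iff y).1 hy
    rw [ofCoeffs_eq_sum, smul_sum]
    refine Submodule.sum_mem _ fun i _ => ?_
    rw [smul_comm, ← scale_vec]
    exact Submodule.smul_mem _ _ (Submodule.subset_span ⟨i, rfl⟩)

/-- `M·y ∈ L(MB)` for `y ∈ L(B)`. [folklore] -/
theorem smul_mem_scale_lattice {y : EuclideanSpace ℝ (Fin I.n)} (hy : y ∈ I.lattice) :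
    (M : ℝ) • y ∈ (I.scale M).lattice :=
  (mem_scale_lattice_iff M I _).2 ⟨y, hy, rfl⟩

/-- Scaling by `M ≠ 0` preserves nonsingularity (`det(MB) = Mⁿ det B`). [folklore] -/
theorem isNonsingular_scale {M : ℕ} (hM : M ≠ 0) {I : LatticeInstance} (hI : I.IsNonsingular) :
    (I.scale M).IsNonsingular := by
  rw [isNonsingular_iff] at hI ⊢
  change ((M : ℤ) • I.basis).det ≠ 0
  rw [Matrix.det_smul, Fintype.card_fin]
  exact mul_ne_zero (pow_ne_zero _ (by exact_mod_cast hM)) hI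

/-- **Gram–Schmidt norms scale**: `‖(MB)~ᵢ‖ = M·‖b̃ᵢ‖` for `M ≠ 0`. [folklore] -/
theorem norm_gramSchmidt_scale {M : ℕ} (hM : M ≠ 0) (I : LatticeInstance) (i : Fin I.n) :
    ‖gramSchmidt ℝ (I.scale M).vec i‖ = (M : ℝ) * ‖gramSchmidt ℝ I.vec i‖ := by
  rw [scale_vec_eq, norm_gramSchmidt_const_smul (by exact_mod_cast hM : (M : ℝ) ≠ 0),
    Nat.abs_cast]

/-- **The minimum distance scales**: `λ₁(L(MB)) = M·λ₁(L(B))`. [folklore] -/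
theorem minNorm_scale_lattice {M : ℕ} (hM : M ≠ 0) (I : LatticeInstance) :
    minNorm (I.scale M).lattice = (M : ℝ) * minNorm I.lattice := by
  have hM' : (0 : ℝ) < M := by exact_mod_cast Nat.pos_of_ne_zero hM
  have hset : ((‖·‖) '' {x : EuclideanSpace ℝ (Fin I.n) | x ∈ (I.scale M).lattice ∧ x ≠ 0}) =
      (M : ℝ) • ((‖·‖) '' {x : EuclideanSpace ℝ (Fin I.n) | x ∈ I.lattice ∧ x ≠ 0}) := by
    ext r
    simp only [Set.mem_image, Set.mem_setOf_eq, Set.mem_smul_set, smul_eq_mul]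
    constructor
    · rintro ⟨x, ⟨hx, hx0⟩, rfl⟩
      obtain ⟨y, hy, rfl⟩ := (mem_scale_lattice_iff M I x).1 hx
      refine ⟨‖y‖, ⟨y, ⟨hy, fun h => hx0 (by rw [h, smul_zero])⟩, rfl⟩, ?_⟩
      rw [norm_smul, Real.norm_of_nonneg hM'.le]
    · rintro ⟨_, ⟨y, ⟨hy, hy0⟩, rfl⟩, rfl⟩
      refine ⟨(M : ℝ) • y, ⟨smul_mem_scale_lattice M I hy, ?_⟩, ?_⟩
      · exact smul_ne_zero hM'.ne' hy0
      · rw [norm_smul, Real.norm_of_nonneg hM'.le]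
  unfold minNorm
  rw [show {x : EuclideanSpace ℝ (Fin (I.scale M).n) | x ∈ (I.scale M).lattice ∧ x ≠ 0} =
      {x : EuclideanSpace ℝ (Fin I.n) | x ∈ (I.scale M).lattice ∧ x ≠ 0} from rfl, hset,
    Real.sInf_smul_of_nonneg hM'.le, smul_eq_mul]

end LatticeInstance

end Literature.Algebra.EuclideanLattices

end
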